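import Mathlib
import Literature.NumberTheory.Automorphic.HilbertModularFormQExpansion
import Summits.Langlands.Langlands.Theorems.CapacityClassicalityHilbertIntegralOverconvergentIsCongruenceStubFourierCoeffMul
import Summits.Langlands.Langlands.Theorems.CapacityClassicalityHilbertIntegralOverconvergentIsCongruenceStubHolNoZeroDivisors
import Summits.Langlands.Langlands.Theorems.CapacityClassicalityHilbertIntegralOverconvergentIsCongruenceStubModularFormCoeffSupport
import Summits.Langlands.Langlands.Theorems.CapacityClassicalityHilbertIntegralOverconvergentIsCongruenceStubModularFormPeriodic
import Summits.Langlands.Langlands.Theorems.CapacityClassicalityHilbertIntegralOverconvergentIsCongruenceStubLeadConvolution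

/-!
# Powers of a seed form are seed forms (stub U7 of line Sketch-ideate-r1-k1)

Stub `stub_seed_pow` (U7) for line Sketch-ideate-r1-k1 of the crux
`HilbertIntegralOverconvergentIsCongruence` (stmt-Langlands-8485).  Section U of the line builds the
supply of Hilbert modular forms of the typed crux from one SEED FORM `s` of weight `w` and level
`Γ₁(𝔫)` over a totally real field `F` of degree `≥ 2`: `a₀(s) = 0`, `s ≢ 0` on `ℍ`, and
rational-integer Fourier coefficients on the cone `qIndexSet F`.  For parallel weights the shift form
is a power of the seed, so we need: for `i ≥ 1` the power `s^i` is again a seed form, of weight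
`i • w`.

Proof (induction on `i ≥ 1`, `Nat.le_induction`; `s^(j+1) = s^j · s`, `(j+1) • w = j • w + w`):
* membership: products of Hilbert modular forms are Hilbert modular forms, weights add
  (`mul_mem_modularForms`);
* non-vanishing: if `s^j · s` vanished on all of `ℍ`, then — `s^j` being holomorphic and not
  identically zero on `ℍ` — `s` would vanish on `ℍ` (no zero divisors among holomorphic functions on
  `ℍ`, the landed `stub_hol_noZeroDivisors`), contradicting `s ≢ 0`;
* coefficients: by the landed product formula `stub_fourierCoeff_mul` (its periodicity and
  cone-support hypotheses are supplied for forms of level `Γ₁(𝔫)`, `𝔫 ≠ 0`, `[F:ℚ] ≥ 2`, by the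
  landed `stub_modularForm_periodic` and `stub_modularForm_coeff_support`),
  `a_ν(s^j · s) = ∑_{(μ, μ')} a_μ(s^j) a_{μ'}(s)` over the finitely many pairs of cone indices with
  `μ + μ' = ν` (`stub_finite_qIndex_antidiagonal`); each summand is a product of two integers, so
  `a_ν(s^(j+1))` is the integer `∑ zj(μ) zc(μ')`; and at `ν = 0` the only cone pair is `(0, 0)` (cone
  elements are `0` or totally positive: compare at a real embedding), so
  `a₀(s^(j+1)) = a₀(s^j) a₀(s) = 0`.
-/

set_option linter.dupNamespace false

noncomputable section

namespace Summit.Langlands.Langlands.Theorems.HilbertIntegralOverconvergentIsCongruence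

open MeasureTheory Complex NumberField
open Literature.NumberTheory.Automorphic Literature.NumberTheory.Automorphic.HilbertModular

/-- The product formula for the Fourier coefficients of two Hilbert modular forms of level `Γ₁(𝔫)`
(`𝔫 ≠ 0`, `[F:ℚ] ≥ 2`) at a cone index `ν`: `a_ν(fg) = ∑_{μ + μ' = ν} a_μ(f) a_{μ'}(g)` over the
pairs of cone indices (the landed `stub_fourierCoeff_mul`, with periodicity from
`stub_modularForm_periodic` and cone support from `stub_modularForm_coeff_support`). -/
theorem spw_fourierCoeff_mul_modularForm (F : Type) [Field F] [NumberField F]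
    [NumberField.IsTotallyReal F] (hd : 1 < Module.finrank ℚ F) (𝔫 : Ideal (𝓞 F)) (h𝔫 : 𝔫 ≠ ⊥)
    {k k' : (F →+* ℝ) → ℤ} {f g : Point F → ℂ} (hf : f ∈ modularForms (Bianchi.Gamma1 𝔫) k)
    (hg : g ∈ modularForms (Bianchi.Gamma1 𝔫) k') {ν : F} (hν : ν ∈ qIndexSet F)
    (T : Finset (F × F))
    (hT : ∀ μ : F × F, μ ∈ T ↔ μ.1 ∈ qIndexSet F ∧ μ.2 ∈ qIndexSet F ∧ μ.1 + μ.2 = ν) :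
    fourierCoeff (f * g) ν = ∑ μ ∈ T, fourierCoeff f μ.1 * fourierCoeff g μ.2 :=
  stub_fourierCoeff_mul F f g (mem_modularForms_iff.mp hf).holomorphic
    (mem_modularForms_iff.mp hg).holomorphic (stub_modularForm_periodic F 𝔫 k f hf)
    (stub_modularForm_periodic F 𝔫 k' g hg)
    (fun μ hμ hμc ↦ stub_modularForm_coeff_support F hd 𝔫 h𝔫 k f hf μ hμ hμc)
    (fun μ hμ hμc ↦ stub_modularForm_coeff_support F hd 𝔫 h𝔫 k' g hg μ hμ hμc) ν
    (mem_qIndexSet_iff.mp hν).1 T hT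

/-- The only pair of cone indices summing to `0` is `(0, 0)`: cone elements are `0` or totally
positive, and at a real embedding `σ` of the totally real field `F` (there is one) a sum of two
totally non-negative elements one of which is totally positive is positive. -/
theorem spw_eq_zero_of_add_eq_zero (F : Type) [Field F] [NumberField F]
    [NumberField.IsTotallyReal F] {μ μ' : F} (hμ : μ ∈ qIndexSet F) (hμ' : μ' ∈ qIndexSet F)
    (h : μ + μ' = 0) : μ = 0 ∧ μ' = 0 := by
  have hμ0 : μ = 0 := by
    rcases (mem_qIndexSet_iff.mp hμ).2 with h0 | hpos
    · exact h0
    · exfalso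
      obtain ⟨φ⟩ : Nonempty (F →+* ℂ) := inferInstance
      set σ : F →+* ℝ := (NumberField.IsTotallyReal.complexEmbedding_isReal φ).embedding
      have hσ : σ μ + σ μ' = 0 := by rw [← map_add, h, map_zero]
      have h1 := hpos σ
      have h2 := fqa_nonneg_of_mem_qIndexSet hμ' σ
      linarith
  refine ⟨hμ0, ?_⟩
  rwa [hμ0, zero_add] at h

/-- **stub U7 — `stub_seed_pow` (powers of a seed are seeds).** For a seed form `s ∈ M_w(Γ₁(𝔫))`
(`a₀(s) = 0`, `s ≢ 0` on `ℍ`, integer coefficients on the cone) and `i ≥ 1`, the power `s^i` lies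
in `M_{i•w}(Γ₁(𝔫))` (`mul_mem_modularForms`), does not vanish identically on `ℍ` (no zero divisors
among holomorphic functions on `ℍ`, `stub_hol_noZeroDivisors`), has `a₀(s^i) = 0` and integer
coefficients on the cone (product formula `stub_fourierCoeff_mul`: the only cone pair summing to `0`
is `(0,0)`; convolutions of integers are integers; coefficient support
`stub_modularForm_coeff_support`). [folklore] -/
theorem stub_seed_pow (F : Type) [Field F] [NumberField F] [NumberField.IsTotallyReal F]
    (hd : 1 < Module.finrank ℚ F) (𝔫 : Ideal (𝓞 F)) (h𝔫 : 𝔫 ≠ ⊥) (w : (F →+* ℝ) → ℤ) (s : Point F → ℂ)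
    (hs : s ∈ modularForms (Bianchi.Gamma1 𝔫) w) (hs0 : ∃ z ∈ halfSpace F, s z ≠ 0)
    (hcusp : fourierCoeff s 0 = 0) (zc : F → ℤ) (hzc : ∀ ν ∈ qIndexSet F, fourierCoeff s ν = (zc ν : ℂ))
    (i : ℕ) (hi : 1 ≤ i) :
    s ^ i ∈ modularForms (Bianchi.Gamma1 𝔫) (i • w) ∧ (∃ z ∈ halfSpace F, (s ^ i) z ≠ 0) ∧
      fourierCoeff (s ^ i) 0 = 0 ∧ ∃ zi : F → ℤ, ∀ ν ∈ qIndexSet F, fourierCoeff (s ^ i) ν = (zi ν : ℂ) := by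
  induction i, hi using Nat.le_induction with
  | base =>
    rw [pow_one, one_nsmul]
    exact ⟨hs, hs0, hcusp, zc, hzc⟩
  | succ j hj ih =>
    obtain ⟨hmem, hne, hcuspj, zj, hzj⟩ := ih
    rw [pow_succ, succ_nsmul]
    -- the product formula for `s^j · s` at a cone index
    have hmul : ∀ ν ∈ qIndexSet F, ∀ T : Finset (F × F),
        (∀ μ : F × F, μ ∈ T ↔ μ.1 ∈ qIndexSet F ∧ μ.2 ∈ qIndexSet F ∧ μ.1 + μ.2 = ν) →
        fourierCoeff (s ^ j * s) ν = ∑ μ ∈ T, fourierCoeff (s ^ j) μ.1 * fourierCoeff s μ.2 :=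
      fun ν hν T hT ↦ spw_fourierCoeff_mul_modularForm F hd 𝔫 h𝔫 hmem hs hν T hT
    refine ⟨mul_mem_modularForms hmem hs, ?_, ?_, ?_⟩
    · -- `s^j · s ≢ 0` on `ℍ`: otherwise `s ≡ 0` on `ℍ` (no zero divisors), contradicting `hs0`
      by_contra hall
      have hfg : ∀ z ∈ halfSpace F, (s ^ j) z * s z = 0 := fun z hz ↦ by
        by_contra hz0
        exact hall ⟨z, hz, hz0⟩
      have hzero := stub_hol_noZeroDivisors F (s ^ j) s (mem_modularForms_iff.mp hmem).holomorphic
        (mem_modularForms_iff.mp hs).holomorphic hfg hne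
      obtain ⟨z, hz, hsz⟩ := hs0
      exact hsz (hzero z hz)
    · -- `a₀(s^j · s) = a₀(s^j) a₀(s) = 0`: the only cone pair summing to `0` is `(0, 0)`
      obtain ⟨T, hT⟩ := lcv_exists_antidiagonal_finset F (0 : F)
      rw [hmul 0 zero_mem_qIndexSet T hT]
      refine Finset.sum_eq_zero fun μ hμ ↦ ?_
      obtain ⟨hμ1, hμ2, hsum⟩ := (hT μ).1 hμ
      obtain ⟨h1, -⟩ := spw_eq_zero_of_add_eq_zero F hμ1 hμ2 hsum
      rw [h1, hcuspj, zero_mul]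
    · -- integrality: every summand of the convolution is a product of two integers
      refine ⟨fun ν ↦ ∑ μ ∈ (stub_finite_qIndex_antidiagonal F ν).toFinset, zj μ.1 * zc μ.2,
        fun ν hν ↦ ?_⟩
      have hT : ∀ μ : F × F, μ ∈ (stub_finite_qIndex_antidiagonal F ν).toFinset ↔
          μ.1 ∈ qIndexSet F ∧ μ.2 ∈ qIndexSet F ∧ μ.1 + μ.2 = ν :=
        fun μ ↦ (Set.Finite.mem_toFinset _).trans Iff.rfl
      rw [hmul ν hν _ hT]
      push_cast
      refine Finset.sum_congr rfl fun μ hμ ↦ ?_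
      obtain ⟨hμ1, hμ2, -⟩ := (hT μ).1 hμ
      rw [hzj μ.1 hμ1, hzc μ.2 hμ2]

end Summit.Langlands.Langlands.Theorems.HilbertIntegralOverconvergentIsCongruence
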